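import Summits.ResolutionOfSingularities.KangarooAtlas.MizutaniThetaEchelon
import Mathlib.RingTheory.Adjoin.Polynomial.Basic
import Mathlib.FieldTheory.IntermediateField.Adjoin.Algebra
import HarnessLib

/-!
# Vectors with coordinates in a simple height-one subfield `L(α)` of the tower (Mizutani 1973, proof of Thm. 2.8, case (2))

Cell `pub-rosobs`, Mizutani enclosure (seat mizutani-encloser-2, gen 7). AI-written; AI review is weaker than expert
review; NOT a resolution-of-singularities theorem (summit relevance C).

Mizutani's case (2) (Nagoya Math. J. 52 (1973), p. 90–91): when the coefficients of the echelon generators of `Diff_i(k)f` lie in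
simple height-one extensions `k^p(a_j)`, he uses (i) `k^p(a) ∩ u·k^p(a') ⊆ k^p`-line for `k^p(a) ≠ k^p(a')` and (ii) for
`c(f) ⊂ k^p(a)`: «if `D` is a derivation with `D(a) = 1`, there exists `s ≤ p − 1` such that `D^s(f) ≠ 0` and `D^{s+1}(f) = 0`. So
`0 ≠ D^s(f) ∈ θ_1(f) ∩ W`».  This file provides (ii) and the propagation of `k^p(a)`-rationality along the chain `Θ_m(v)` at tower
level (`h : IsRootTower L K p x a`, `E = L(α)` with `∂_{l₀} α ≠ 0`, `∇ = (∂_{l₀}α)^{-1} ∂_{l₀}`):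

* `IsRootTower.nabla`, `nabla_self` (`∇α = 1`), `exists_aeval_of_mem_adjoin` (elements of `L(α)` are polynomials in `α`),
  **`der_eq_mul_nabla`** (`∂_l z = ∂_l α · ∇z` on `L(α)`), `nabla_mem_adjoin` (`∇ L(α) ⊆ L(α)`), `iterate_derivative_eq_zero_of_charP`,
  **`nabla_iterate_char_eq_zero`** (`∇^p = 0` on `L(α)`), `exists_eq_algebraMap_of_nabla_eq_zero` (`ker ∇ ∩ L(α) = L`);
* vectors: `IsRootTower.nvec` (coordinatewise `∇`), `dvec_eq_smul_nvec`, `nvec_mem_thetaSpan_succ`, `nvec_iterate_mem_thetaSpan`,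
  **`exists_rational_mem_thetaSpan`** — a nonzero `L(α)`-vector `w` has a nonzero `L`-RATIONAL vector in `Θ_{p−1}(w)` (Mizutani's `D^s(f) ∈ W`);
* **`IsRootTower.exists_rational_span_thetaSpan_of_le`** — if `Θ_m(v)` is spanned by `L(α)`-vectors then so is every `Θ_j(v)`, `j ≥ m`
  (at exponent one `Θ_{j+1} = span (G ∪ ∇G)`).

## References

* H. Mizutani, *Hironaka's additive group schemes*, Nagoya Math. J. 52 (1973) 85–95, proof of Thm. 2.8, case (2)(ii) (p. 91).
  [Mizutani1973HironakaGroupSchemes]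
* H. Matsumura, *Commutative Ring Theory*, §26 (p-bases and derivations). [Matsumura1987]
-/

noncomputable section

open MvPolynomial Literature.AlgebraicGeometry.Resolution

namespace Summit.ResolutionOfSingularities.KangarooAtlas.Mizutani

universe u

/-! ## The derivation `∇ = (∂_{l₀} α)^{-1} ∂_{l₀}` and the field `L(α)` -/

section Nabla

variable {L K : Type u} [Field L] [Field K] [Algebra L K] {s p : ℕ} [hp : Fact p.Prime] [CharP K p]
  {x : Fin s → L} {a : Fin s → K}

/-- `∇ = (∂_{l₀} α)^{-1} · ∂_{l₀}` (Mizutani's «derivation `D` with `D(a) = 1`», realised inside the tower).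
[cite: Mizutani1973HironakaGroupSchemes, proof of Thm. 2.8, case (2)(ii)] -/
def IsRootTower.nabla (h : IsRootTower L K (p ^ 1) x a) (l₀ : Fin s) (α : K) : Derivation L K K :=
  (h.der le_rfl l₀ α)⁻¹ • h.der le_rfl l₀

/-- `∇z = (∂_{l₀} α)^{-1} ∂_{l₀} z`. [folklore] -/
theorem IsRootTower.nabla_apply (h : IsRootTower L K (p ^ 1) x a) (l₀ : Fin s) (α z : K) :
    h.nabla l₀ α z = (h.der le_rfl l₀ α)⁻¹ * h.der le_rfl l₀ z := by
  rw [IsRootTower.nabla, Derivation.smul_apply, smul_eq_mul]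

/-- `∇α = 1`. [folklore] -/
theorem IsRootTower.nabla_self (h : IsRootTower L K (p ^ 1) x a) {l₀ : Fin s} {α : K} (hα : h.der le_rfl l₀ α ≠ 0) :
    h.nabla l₀ α α = 1 := by
  rw [h.nabla_apply, inv_mul_cancel₀ hα]

omit [CharP K p] in
/-- Elements of `L(α)` are polynomials in `α` (`α` is algebraic: the tower is finite over `L`). [folklore] -/
theorem IsRootTower.exists_aeval_of_mem_adjoin {e : ℕ} {x' : Fin s → L} {a' : Fin s → K} (h : IsRootTower L K (p ^ e) x' a')
    {α z : K} (hz : z ∈ IntermediateField.adjoin L {α}) : ∃ q : Polynomial L, z = Polynomial.aeval α q := by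
  haveI := h.finiteDimensional
  have halg : IsAlgebraic L α := Algebra.IsAlgebraic.isAlgebraic α
  rw [← IntermediateField.mem_toSubalgebra, IntermediateField.adjoin_simple_toSubalgebra_of_isAlgebraic halg,
    Algebra.adjoin_singleton_eq_range_aeval, AlgHom.mem_range] at hz
  obtain ⟨q, hq⟩ := hz
  exact ⟨q, hq.symm⟩

omit [CharP K p] in
/-- Polynomials in `α` lie in `L(α)`. [folklore] -/
theorem aeval_mem_adjoin_simple (α : K) (q : Polynomial L) : Polynomial.aeval α q ∈ IntermediateField.adjoin L {α} :=
  IntermediateField.algebra_adjoin_le_adjoin L {α} (Polynomial.aeval_mem_adjoin_singleton L α)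

/-- **`∂_l z = ∂_l α · ∇z` on `L(α)`** (chain rule: `dz ∥ dα` for `z = q(α)`). [cite: Mizutani1973HironakaGroupSchemes, proof of Thm. 2.8, case (2)] -/
theorem IsRootTower.der_eq_mul_nabla (h : IsRootTower L K (p ^ 1) x a) {l₀ : Fin s} {α : K} (hα : h.der le_rfl l₀ α ≠ 0) {z : K}
    (hz : z ∈ IntermediateField.adjoin L {α}) (l : Fin s) : h.der le_rfl l z = h.der le_rfl l α * h.nabla l₀ α z := by
  obtain ⟨q, rfl⟩ := h.exists_aeval_of_mem_adjoin hz
  rw [h.nabla_apply, Derivation.map_aeval, Derivation.map_aeval, smul_eq_mul, smul_eq_mul]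
  field_simp

/-- **`∇ L(α) ⊆ L(α)`** (`∇ q(α) = q'(α)`). [folklore] -/
theorem IsRootTower.nabla_mem_adjoin (h : IsRootTower L K (p ^ 1) x a) {l₀ : Fin s} {α : K} (hα : h.der le_rfl l₀ α ≠ 0) {z : K}
    (hz : z ∈ IntermediateField.adjoin L {α}) : h.nabla l₀ α z ∈ IntermediateField.adjoin L {α} := by
  obtain ⟨q, rfl⟩ := h.exists_aeval_of_mem_adjoin hz
  rw [Derivation.map_aeval, h.nabla_self hα, smul_eq_mul, mul_one]
  exact aeval_mem_adjoin_simple α _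

/-- In characteristic `p`, the `p`-th derivative of every polynomial vanishes (`(m+p)!/m!` is divisible by `p`). [folklore] -/
theorem iterate_derivative_eq_zero_of_charP {R : Type*} [CommRing R] (p : ℕ) [Fact p.Prime] [CharP R p] (q : Polynomial R) :
    Polynomial.derivative^[p] q = 0 := by
  ext m
  rw [Polynomial.coeff_iterate_derivative, Polynomial.coeff_zero, nsmul_eq_mul]
  have hdvd : p ∣ (m + p).descFactorial p :=
    (Nat.dvd_factorial (Fact.out : p.Prime).pos le_rfl).trans (Nat.factorial_dvd_descFactorial _ _)
  rw [(CharP.cast_eq_zero_iff R p _).mpr hdvd, zero_mul]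

/-- `∇^{[i]} q(α) = q^{(i)}(α)`. [folklore] -/
theorem IsRootTower.nabla_iterate_aeval (h : IsRootTower L K (p ^ 1) x a) {l₀ : Fin s} {α : K} (hα : h.der le_rfl l₀ α ≠ 0)
    (q : Polynomial L) (i : ℕ) :
    (h.nabla l₀ α)^[i] (Polynomial.aeval α q) = Polynomial.aeval α (Polynomial.derivative^[i] q) := by
  induction i generalizing q with
  | zero => rfl
  | succ i ih =>
    rw [Function.iterate_succ_apply, Function.iterate_succ_apply, ← ih, Derivation.map_aeval, h.nabla_self hα, smul_eq_mul,
      mul_one]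

/-- **`∇^p = 0` on `L(α)`** (Mizutani: «there exists `s ≤ p − 1` such that `D^s(f) ≠ 0` and `D^{s+1}(f) = 0`»).
[cite: Mizutani1973HironakaGroupSchemes, proof of Thm. 2.8, case (2)(ii) (p. 91)] -/
theorem IsRootTower.nabla_iterate_char_eq_zero (h : IsRootTower L K (p ^ 1) x a) {l₀ : Fin s} {α : K} (hα : h.der le_rfl l₀ α ≠ 0)
    {z : K} (hz : z ∈ IntermediateField.adjoin L {α}) : (h.nabla l₀ α)^[p] z = 0 := by
  obtain ⟨q, rfl⟩ := h.exists_aeval_of_mem_adjoin hz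
  haveI : CharP L p := (algebraMap L K).charP (algebraMap L K).injective p
  rw [h.nabla_iterate_aeval hα, iterate_derivative_eq_zero_of_charP p q, map_zero]

/-- **`ker ∇ ∩ L(α) = L`** (towers with `K^p ⊆ L`): `∇z = 0` forces all `∂_l z = 0`. [cite: Mizutani1973HironakaGroupSchemes, proof of Thm. 2.8, case (2)(ii) («D^s(f) ∈ W»)] -/
theorem IsRootTower.exists_eq_algebraMap_of_nabla_eq_zero (h : IsRootTower L K (p ^ 1) x a)
    (hKp : ∀ y : K, y ^ p ∈ (algebraMap L K).range) {l₀ : Fin s} {α : K} (hα : h.der le_rfl l₀ α ≠ 0) {z : K}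
    (hz : z ∈ IntermediateField.adjoin L {α}) (h0 : h.nabla l₀ α z = 0) : ∃ c : L, algebraMap L K c = z :=
  h.exists_eq_algebraMap_of_der_eq_zero le_rfl hKp fun l => by rw [h.der_eq_mul_nabla hα hz l, h0, mul_zero]

end Nabla

/-! ## `L(α)`-vectors: `∂_l w = ∂_l α · ∇w`, `∇^{[i]} w ∈ Θ_i(w)`, and the rational vector `∇^{[s]} w` -/

section NablaVectors

variable {L K : Type u} [Field L] [Field K] [Algebra L K] {s p : ℕ} [hp : Fact p.Prime] [CharP K p]
  {x : Fin s → L} {a : Fin s → K} {ι : Type*}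

/-- The coordinatewise `∇w = (∇ w_i)_i`. [folklore] -/
def IsRootTower.nvec (h : IsRootTower L K (p ^ 1) x a) (l₀ : Fin s) (α : K) (w : ι → K) : ι → K :=
  fun i => h.nabla l₀ α (w i)

/-- `∇w` unfolded. [folklore] -/
theorem IsRootTower.nvec_apply (h : IsRootTower L K (p ^ 1) x a) (l₀ : Fin s) (α : K) (w : ι → K) (i : ι) :
    h.nvec l₀ α w i = h.nabla l₀ α (w i) := rfl

/-- `∇w = (∂_{l₀} α)^{-1} · ∂_{l₀} w` (any vector). [folklore] -/
theorem IsRootTower.nvec_eq_smul_dvec (h : IsRootTower L K (p ^ 1) x a) (l₀ : Fin s) (α : K) (w : ι → K) :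
    h.nvec l₀ α w = (h.der le_rfl l₀ α)⁻¹ • h.dvec l₀ w := by
  funext i
  rw [h.nvec_apply, Pi.smul_apply, h.dvec_apply, smul_eq_mul, h.nabla_apply, h.der_apply, h.der_apply]

/-- **`∂_l w = ∂_l α · ∇w` for an `L(α)`-vector `w`.** [cite: Mizutani1973HironakaGroupSchemes, proof of Thm. 2.8, case (2)] -/
theorem IsRootTower.dvec_eq_smul_nvec (h : IsRootTower L K (p ^ 1) x a) {l₀ : Fin s} {α : K} (hα : h.der le_rfl l₀ α ≠ 0)
    {w : ι → K} (hw : ∀ i, w i ∈ IntermediateField.adjoin L {α}) (l : Fin s) :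
    h.dvec l w = h.der le_rfl l α • h.nvec l₀ α w := by
  funext i
  rw [h.dvec_apply, Pi.smul_apply, smul_eq_mul, h.nvec_apply, ← h.der_apply le_rfl l (w i), h.der_eq_mul_nabla hα (hw i) l]

/-- `∇` preserves `L(α)`-vectors. [folklore] -/
theorem IsRootTower.nvec_mem_adjoin (h : IsRootTower L K (p ^ 1) x a) {l₀ : Fin s} {α : K} (hα : h.der le_rfl l₀ α ≠ 0)
    {w : ι → K} (hw : ∀ i, w i ∈ IntermediateField.adjoin L {α}) (i : ι) :
    h.nvec l₀ α w i ∈ IntermediateField.adjoin L {α} :=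
  h.nabla_mem_adjoin hα (hw i)

/-- Iterates of `∇` preserve `L(α)`-vectors. [folklore] -/
theorem IsRootTower.nvec_iterate_mem_adjoin (h : IsRootTower L K (p ^ 1) x a) {l₀ : Fin s} {α : K} (hα : h.der le_rfl l₀ α ≠ 0)
    {w : ι → K} (hw : ∀ i, w i ∈ IntermediateField.adjoin L {α}) (n : ℕ) (i : ι) :
    (h.nvec l₀ α)^[n] w i ∈ IntermediateField.adjoin L {α} := by
  induction n with
  | zero => exact hw i
  | succ n ih' =>
    rw [Function.iterate_succ_apply']
    exact h.nabla_mem_adjoin hα (by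
      have : ∀ i, (h.nvec l₀ α)^[n] w i ∈ IntermediateField.adjoin L {α} := fun i => by
        clear ih'
        induction n with
        | zero => exact hw i
        | succ n ih => rw [Function.iterate_succ_apply']; exact h.nabla_mem_adjoin hα (ih)
      exact this i)

/-- The iterates of `∇` act coordinatewise. [folklore] -/
theorem IsRootTower.nvec_iterate_apply (h : IsRootTower L K (p ^ 1) x a) (l₀ : Fin s) (α : K) (w : ι → K) (n : ℕ) (i : ι) :
    (h.nvec l₀ α)^[n] w i = (h.nabla l₀ α)^[n] (w i) := by
  induction n with
  | zero => rfl
  | succ n ih => rw [Function.iterate_succ_apply', Function.iterate_succ_apply', h.nvec_apply, ih]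

/-- `∇^{[p]} w = 0` for an `L(α)`-vector. [cite: Mizutani1973HironakaGroupSchemes, proof of Thm. 2.8, case (2)(ii)] -/
theorem IsRootTower.nvec_iterate_char_eq_zero (h : IsRootTower L K (p ^ 1) x a) {l₀ : Fin s} {α : K}
    (hα : h.der le_rfl l₀ α ≠ 0) {w : ι → K} (hw : ∀ i, w i ∈ IntermediateField.adjoin L {α}) :
    (h.nvec l₀ α)^[p] w = 0 := by
  funext i
  rw [h.nvec_iterate_apply, Pi.zero_apply]
  exact h.nabla_iterate_char_eq_zero hα (hw i)

/-- `∇ Θ_m(v) ⊆ Θ_{m+1}(v)` (`∇` is a multiple of `∂_{l₀}`). [folklore] -/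
theorem IsRootTower.nvec_mem_thetaSpan_succ (h : IsRootTower L K (p ^ 1) x a) (l₀ : Fin s) (α : K) {m : ℕ} (v : ι → K)
    {θ : ι → K} (hθ : θ ∈ h.thetaSpan m v) : h.nvec l₀ α θ ∈ h.thetaSpan (m + 1) v := by
  rw [h.nvec_eq_smul_dvec]
  exact Submodule.smul_mem _ _ (h.dvec_mem_thetaSpan_succ le_rfl v l₀ hθ)

/-- `∇^{[n]} w ∈ Θ_n(w)`. [cite: Mizutani1973HironakaGroupSchemes, proof of Thm. 2.8, case (2)(ii) («D^s(f) ∈ θ_1(f)»)] -/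
theorem IsRootTower.nvec_iterate_mem_thetaSpan (h : IsRootTower L K (p ^ 1) x a) (l₀ : Fin s) (α : K) (w : ι → K) (n : ℕ) :
    (h.nvec l₀ α)^[n] w ∈ h.thetaSpan n w := by
  induction n with
  | zero => exact h.self_mem_thetaSpan 0 w
  | succ n ih => rw [Function.iterate_succ_apply']; exact h.nvec_mem_thetaSpan_succ l₀ α w ih

variable [Fintype ι]

/-- **The rational vector** (Mizutani's `0 ≠ D^s(f) ∈ θ_1(f) ∩ W`): a nonzero vector `w` with coordinates in `L(α)` has a nonzero
`L`-rational vector `λ = ∇^{[s]} w` (`s ≤ p − 1`) in `Θ_{p−1}(w)` (towers with `K^p ⊆ L`).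
[cite: Mizutani1973HironakaGroupSchemes, proof of Thm. 2.8, case (2)(ii) (p. 91)] -/
theorem IsRootTower.exists_rational_mem_thetaSpan (h : IsRootTower L K (p ^ 1) x a)
    (hKp : ∀ y : K, y ^ p ∈ (algebraMap L K).range) {l₀ : Fin s} {α : K} (hα : h.der le_rfl l₀ α ≠ 0)
    {w : ι → K} (hw : ∀ i, w i ∈ IntermediateField.adjoin L {α}) (hw0 : w ≠ 0) :
    ∃ lam ∈ h.thetaSpan (p - 1) w, lam ≠ 0 ∧ ∀ i, lam i ∈ (algebraMap L K).range := by
  classical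
  have hex : ∃ n, (h.nvec l₀ α)^[n + 1] w = 0 :=
    ⟨p - 1, by rw [Nat.sub_add_cancel hp.out.one_lt.le]; exact h.nvec_iterate_char_eq_zero hα hw⟩
  set n := Nat.find hex with hn
  have hn1 : (h.nvec l₀ α)^[n + 1] w = 0 := Nat.find_spec hex
  have hnle : n ≤ p - 1 := Nat.find_le (by rw [Nat.sub_add_cancel hp.out.one_lt.le]; exact h.nvec_iterate_char_eq_zero hα hw)
  have hn0 : (h.nvec l₀ α)^[n] w ≠ 0 := by
    rcases Nat.eq_zero_or_pos n with h0 | hpos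
    · rw [h0]; exact hw0
    · have := Nat.find_min hex (m := n - 1) (by omega)
      rwa [Nat.sub_add_cancel hpos] at this
  refine ⟨(h.nvec l₀ α)^[n] w, h.thetaSpan_mono hnle w (h.nvec_iterate_mem_thetaSpan l₀ α w n), hn0, fun i => ?_⟩
  obtain ⟨c, hc⟩ := h.exists_eq_algebraMap_of_nabla_eq_zero hKp hα (h.nvec_iterate_mem_adjoin hα hw n i) (by
    have := congrFun hn1 i
    rwa [Function.iterate_succ_apply', h.nvec_apply] at this)
  exact ⟨c, hc⟩

end NablaVectors

/-! ## Propagation: `L(α)`-rational spans stay `L(α)`-rational along `Θ_m(v) ⊆ Θ_{m+1}(v) ⊆ ⋯` -/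

section Propagation

variable {L K : Type u} [Field L] [Field K] [Algebra L K] {s p : ℕ} [hp : Fact p.Prime] [CharP K p]
  {x : Fin s → L} {a : Fin s → K} {ι : Type*}

/-- One step: if `Θ_m(v) = span_K G` with `G ⊆ L(α)^ι`, then `Θ_{m+1}(v) = span_K (G ∪ ∇G)` and `G ∪ ∇G ⊆ L(α)^ι`.
[cite: Mizutani1973HironakaGroupSchemes, proof of Thm. 2.8, case (2)(ii) («θ_i(f) = k·(θ_i(f) ∩ (k^p(a) ⊗ W))»)] -/
theorem IsRootTower.thetaSpan_succ_eq_span_union_nvec (h : IsRootTower L K (p ^ 1) x a) {l₀ : Fin s} {α : K}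
    (hα : h.der le_rfl l₀ α ≠ 0) {m : ℕ} {v : ι → K} {G : Set (ι → K)} (hG : ∀ g ∈ G, ∀ i, g i ∈ IntermediateField.adjoin L {α})
    (hΘ : h.thetaSpan m v = Submodule.span K G) :
    h.thetaSpan (m + 1) v = Submodule.span K (G ∪ h.nvec l₀ α '' G) := by
  have hS : G ⊆ h.thetaSpan m v := by rw [hΘ]; exact Submodule.subset_span
  rw [h.thetaSpan_succ_eq_span m v hS hΘ.le]
  apply le_antisymm
  · rw [Submodule.span_le]
    rintro g (hg | ⟨l, g', hg', rfl⟩)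
    · exact Submodule.subset_span (Or.inl hg)
    · rw [SetLike.mem_coe, h.dvec_eq_smul_nvec hα (hG g' hg') l]
      exact Submodule.smul_mem _ _ (Submodule.subset_span (Or.inr ⟨g', hg', rfl⟩))
  · rw [Submodule.span_le]
    rintro g (hg | ⟨g', hg', rfl⟩)
    · exact Submodule.subset_span (Or.inl hg)
    · rw [SetLike.mem_coe, h.nvec_eq_smul_dvec]
      exact Submodule.smul_mem _ _ (Submodule.subset_span (Or.inr (h.dvec_mem_derivSet l₀ hg')))

/-- **Propagation of `L(α)`-rationality**: if `Θ_m(v)` is spanned by `L(α)`-vectors then so is `Θ_j(v)` for every `j ≥ m` (exponent one).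
[cite: Mizutani1973HironakaGroupSchemes, proof of Thm. 2.8, case (2)(ii) (p. 91)] -/
theorem IsRootTower.exists_rational_span_thetaSpan_of_le (h : IsRootTower L K (p ^ 1) x a) {l₀ : Fin s} {α : K}
    (hα : h.der le_rfl l₀ α ≠ 0) {m : ℕ} {v : ι → K} {G : Set (ι → K)} (hG : ∀ g ∈ G, ∀ i, g i ∈ IntermediateField.adjoin L {α})
    (hΘ : h.thetaSpan m v = Submodule.span K G) {j : ℕ} (hj : m ≤ j) :
    ∃ G' : Set (ι → K), (∀ g ∈ G', ∀ i, g i ∈ IntermediateField.adjoin L {α}) ∧ h.thetaSpan j v = Submodule.span K G' := by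
  induction j, hj using Nat.le_induction with
  | base => exact ⟨G, hG, hΘ⟩
  | succ j _ ih =>
    obtain ⟨G', hG', hΘ'⟩ := ih
    refine ⟨G' ∪ h.nvec l₀ α '' G', ?_, h.thetaSpan_succ_eq_span_union_nvec hα hG' hΘ'⟩
    rintro g (hg | ⟨g', hg', rfl⟩) i
    · exact hG' g hg i
    · exact h.nvec_mem_adjoin hα (hG' g' hg') i

end Propagation

end Summit.ResolutionOfSingularities.KangarooAtlas.Mizutani

end
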